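import Literature.Probability.Percolation.TriLowestCrossing
import Literature.Probability.Percolation.TriAnnulusArms
import HarnessLib

/-!
# Lowest crossings: the two probability estimates of Nolin's Lemma 15 (abstract form)

Topic: Probability / Percolation; family `crit-perc`. The measure-theoretic layer of the abstract
lowest-crossing toolkit `JDomain` (`TriLowestCrossing.lean`), a brick of the discharge of
`Literature.Probability.Percolation.Nolin2008_twoArm_separation` (Nolin 2008, Thm. 11
[arXiv 0711.4948: Thm. 10]; `ArmSeparation.lean`). In the proof of Nolin's Lemma 15
[arXiv Lemma 14] ("any set of disjoint crossings can be made well-separated with probability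
`≥ 1 - δ`"), once the exploration sequence `c₁ < c₂ < ⋯` (our `JDomain.lowestSeq`) is set up,
two estimates are combined:

> "`P(t ≥ T) ≤ (1-δ')^T ≤ δ/4`" (the number of terms is the number of disjoint crossings, BK) and
> "Summing over all possibilities for `c̃_i, σ̃_i (1 ≤ i ≤ u)`, we get that
> `P(t ≥ u and c_u is not protected from above) ≤ (1-δ'')^{-C log η}`" (the event
> `{c_v = c̃_v, v ≤ u}` is independent of the sites above `c̃_u`, where the protecting circuits live),
> so that `P(𝒞 is not η-well-separated) ≤ P(t ≥ T) + Σ_{u<T} P(t ≥ u, c_u not protected) + ⋯`.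

Both are proved here for an arbitrary `JDomain` satisfying `CutProp`/`DualProp`, Bernoulli site
percolation `sitePercolation (Site 2) p` at any `p`, and an arbitrary family of "protection"
events, each determined by finitely many sites off the region on-or-below its crossing:

* `JDomain.crossEvent` — "some crossing of the domain is open" (increasing, determined by `D`);
  `real_lowestSeq_ne_none_le_pow` — **BK tail**: `P(the T-th term of lowestSeq exists) ≤ P(crossEvent)^{T+1}`
  (the first `T+1` terms are `T+1` disjoint open crossings, `exists_disjoint_family_of_lowestSeq`;
  iterated van den Berg–Kesten `real_disjointOccurrencePow_le_pow`);
* `real_exists_lowestSeq_not_mem_le` — **union bound with conditional independence**: if every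
  crossing `(c, z)` comes with an event `Prot c z` determined by a finite set of sites disjoint
  from `lower c z` and `P((Prot c z)ᶜ) ≤ ε`, then
  `P(∃ u < T, the u-th term (c, z) exists and Prot c z fails) ≤ T · ε`
  (locality `determinedBy_lowestSeq_eq`, independence on disjoint site sets
  `sitePercolation_real_inter_of_disjoint`, and `Σ_{(c,z)} P(lowestSeq u = (c,z)) ≤ 1`).

Closed (white) crossings are handled by the users through colour exchange (`ωᶜ`).

## References

* P. Nolin, *Near-critical percolation in two dimensions*, EJP 13 (2008), §4.4, proof of
  Lemma 15 [arXiv 0711.4948: Lemma 14, displays (4.10)–(4.13)]. [Nolin2008]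
* H. Kesten, *Percolation theory for mathematicians* (1982), §2.3, Prop. 2.3. [KestenPTM1982]
* J. van den Berg, H. Kesten, *Inequalities with applications to percolation and reliability*,
  J. Appl. Probab. 22 (1985) (BK inequality). [vandenBergKestenJAP1985]

Mathlib: `measureReal_biUnion_finset(_le)`, `measureReal_mono`, `Finset.sum_le_sum`. Tree:
`JDomain` API (`TriLowestCrossing.lean`), `sitePercolation_real_inter_of_disjoint`
(`SitePercolationMeasure.lean`), `DeterminedBy.measurableSet_of_finset`, `DeterminedBy.compl`
(`PercolationEvents.lean`, `SiteMonotonicity.lean`), `mem_disjointOccurrencePow_of_pairwise_disjoint`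
(`DisjointOccurrencePow.lean`), `real_disjointOccurrencePow_le_pow` (`TriAnnulusArms.lean`).
-/

noncomputable section

namespace Literature.Probability.Percolation

open LatticeModels MeasureTheory

namespace JDomain

variable (Q : JDomain)

/-- **"Some crossing of the domain is open"** (Nolin 2008, proof of Lemma 15: "the probability of
crossing this domain is less than some `1 - δ'` (by RSW)"). [cite: Nolin2008, §4.4 (arXiv 0711.4948: proof of Lemma 14)] -/
def crossEvent : Set (SiteConfig (Site 2)) := {ω | ∃ c z, Q.IsCrossing c z ∧ (↑c : Set (Site 2)) ⊆ ω}

variable {Q}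

/-- `crossEvent` is increasing. [cite: Nolin2008, §4.4 (arXiv 0711.4948: proof of Lemma 14)] -/
theorem isUpperSet_crossEvent : IsUpperSet Q.crossEvent := by
  rintro ω ω' hle ⟨c, z, hc, hcω⟩
  exact ⟨c, z, hc, hcω.trans hle⟩

/-- `crossEvent` is determined by the sites of the domain. [cite: Nolin2008, §4.4 (arXiv 0711.4948: proof of Lemma 14)] -/
theorem determinedBy_crossEvent : DeterminedBy Q.crossEvent (↑Q.D : Set (Site 2)) := by
  rw [determinedBy_iff]
  intro ω ω' h
  have key : ∀ ω ω' : Set (Site 2), ω ∩ ↑Q.D = ω' ∩ ↑Q.D → ω ∈ Q.crossEvent → ω' ∈ Q.crossEvent := by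
    rintro ω ω' h ⟨c, z, hc, hcω⟩
    refine ⟨c, z, hc, fun v hv => ?_⟩
    have : v ∈ ω ∩ ↑Q.D := ⟨hcω hv, Finset.mem_coe.2 (hc.subset (Finset.mem_coe.1 hv))⟩
    rw [h] at this
    exact this.1
  exact ⟨key ω ω' h, key ω' ω h.symm⟩

/-- The event "the `u`-th term of the exploration sequence is `(c, z)`" is measurable. [cite: KestenPTM1982, §2.3 Prop. 2.3] -/
theorem measurableSet_lowestSeq_eq (hcut : Q.CutProp) (hdual : Q.DualProp) (u : ℕ) (c : Finset (Site 2)) (z : Site 2) :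
    MeasurableSet {ω : Set (Site 2) | Q.lowestSeq ω u = some (c, z)} :=
  (determinedBy_lowestSeq_eq hcut hdual u c z).measurableSet_of_finset

/-- **BK tail of the exploration sequence** (Nolin 2008, proof of Lemma 15, `P(t ≥ T) ≤ (1-δ')^T`):
if the `T`-th term exists there are `T + 1` pairwise disjoint open crossings, an element of the
iterated disjoint occurrence `crossEvent □ ⋯ □ crossEvent`, whose probability is at most
`P(crossEvent)^{T+1}` by the van den Berg–Kesten inequality. [cite: Nolin2008, §4.4 (arXiv 0711.4948: proof of Lemma 14)] -/
theorem real_lowestSeq_ne_none_le_pow (hcut : Q.CutProp) (p : unitInterval) (T : ℕ) :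
    (sitePercolation (Site 2) p).real {ω | Q.lowestSeq ω T ≠ none} ≤
      ((sitePercolation (Site 2) p).real Q.crossEvent) ^ (T + 1) := by
  have hsub : {ω : Set (Site 2) | Q.lowestSeq ω T ≠ none} ⊆ disjointOccurrencePow Q.crossEvent (T + 1) := by
    intro ω hω
    obtain ⟨f, hf, hdisj⟩ := exists_disjoint_family_of_lowestSeq hcut hω
    refine mem_disjointOccurrencePow_of_pairwise_disjoint isUpperSet_crossEvent
      (fun i => (↑(f i).1 : Set (Site 2))) (fun i => (hf i).2) (fun i => ⟨(f i).1, (f i).2, (hf i).1, subset_rfl⟩) ?_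
    intro i j hij
    exact Finset.disjoint_coe.2 (hdisj hij)
  exact (measureReal_mono hsub).trans (real_disjointOccurrencePow_le_pow p determinedBy_crossEvent isUpperSet_crossEvent _)

/-- The probabilities of the disjoint events "the `u`-th term is `(c, z)`" sum to at most one
over any finite set of pairs. [cite: KestenPTM1982, §2.3 Prop. 2.3] -/
theorem sum_real_lowestSeq_eq_le_one (hcut : Q.CutProp) (hdual : Q.DualProp) (p : unitInterval) (u : ℕ)
    (I : Finset (Finset (Site 2) × Site 2)) :
    ∑ q ∈ I, (sitePercolation (Site 2) p).real {ω | Q.lowestSeq ω u = some q} ≤ 1 := by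
  rw [← measureReal_biUnion_finset]
  · exact measureReal_le_one
  · intro q _ q' _ hqq'
    exact disjoint_setOf_lowestSeq_eq hqq'
  · intro q _
    obtain ⟨c, z⟩ := q
    exact measurableSet_lowestSeq_eq hcut hdual u c z

/-- **Union bound with conditional independence** (Nolin 2008, proof of Lemma 15: "the event
`{c_v = c̃_v, v ≤ u}` is independent from the status of the sites above `c̃_u` … Summing over all
possibilities for `c̃_i` we get `P(t ≥ u and c_u is not protected) ≤ ε`"). If each crossing
`(c, z)` of the domain carries an event `Prot c z` determined by a finite set of sites `G c z`
disjoint from `lower c z` with `P((Prot c z)ᶜ) ≤ ε`, then the probability that some term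
`u < T` of the exploration sequence is an unprotected crossing is at most `T ε`. [cite: Nolin2008, §4.4 (arXiv 0711.4948: proof of Lemma 14)] -/
theorem real_exists_lowestSeq_not_mem_le (hcut : Q.CutProp) (hdual : Q.DualProp) (p : unitInterval)
    {Prot : Finset (Site 2) → Site 2 → Set (SiteConfig (Site 2))}
    {G : Finset (Site 2) → Site 2 → Finset (Site 2)} {ε : ℝ} (hε : 0 ≤ ε)
    (hdet : ∀ c z, Q.IsCrossing c z → DeterminedBy (Prot c z) ↑(G c z))
    (hdisj : ∀ c z, Q.IsCrossing c z → Disjoint (Q.lower c z) (G c z))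
    (hprob : ∀ c z, Q.IsCrossing c z → (sitePercolation (Site 2) p).real (Prot c z)ᶜ ≤ ε) (T : ℕ) :
    (sitePercolation (Site 2) p).real
        {ω | ∃ u < T, ∃ c z, Q.lowestSeq ω u = some (c, z) ∧ ω ∉ Prot c z} ≤ T * ε := by
  classical
  -- the finite index set of candidate terms
  set I : Finset (Finset (Site 2) × Site 2) := Q.D.powerset ×ˢ Q.J with hI
  set E : ℕ → Finset (Site 2) × Site 2 → Set (SiteConfig (Site 2)) :=
    fun u q => {ω | Q.lowestSeq ω u = some q} ∩ (Prot q.1 q.2)ᶜ with hE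
  have hcover : {ω : Set (Site 2) | ∃ u < T, ∃ c z, Q.lowestSeq ω u = some (c, z) ∧ ω ∉ Prot c z} ⊆
      ⋃ u ∈ Finset.range T, ⋃ q ∈ I, E u q := by
    rintro ω ⟨u, hu, c, z, h, hP⟩
    have hc := (isCrossing_of_lowestSeq h).1
    simp only [Set.mem_iUnion, Finset.mem_range, exists_prop]
    refine ⟨u, hu, (c, z), ?_, h, hP⟩
    rw [hI, Finset.mem_product, Finset.mem_powerset]
    exact ⟨hc.subset, hc.tip_mem_J⟩
  -- each term factorises
  have hterm : ∀ u, ∀ q ∈ I, (sitePercolation (Site 2) p).real (E u q) ≤ (sitePercolation (Site 2) p).real {ω | Q.lowestSeq ω u = some q} * ε := by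
    intro u q _
    obtain ⟨c, z⟩ := q
    by_cases hc : Q.IsCrossing c z
    · have h1 : (sitePercolation (Site 2) p).real (E u (c, z)) =
          (sitePercolation (Site 2) p).real {ω | Q.lowestSeq ω u = some (c, z)} * (sitePercolation (Site 2) p).real (Prot c z)ᶜ := by
        rw [hE]
        exact sitePercolation_real_inter_of_disjoint p (determinedBy_lowestSeq_eq hcut hdual u c z)
          ((hdet c z hc).compl) (hdisj c z hc)
      rw [h1]
      exact mul_le_mul_of_nonneg_left (hprob c z hc) measureReal_nonneg
    · have h0 : E u (c, z) = ∅ := by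
        rw [hE, Set.eq_empty_iff_forall_notMem]
        rintro ω ⟨hω, -⟩
        exact hc (isCrossing_of_lowestSeq hω).1
      rw [h0, measureReal_empty]
      exact mul_nonneg measureReal_nonneg hε
  calc (sitePercolation (Site 2) p).real {ω | ∃ u < T, ∃ c z, Q.lowestSeq ω u = some (c, z) ∧ ω ∉ Prot c z}
      ≤ (sitePercolation (Site 2) p).real (⋃ u ∈ Finset.range T, ⋃ q ∈ I, E u q) :=
        measureReal_mono hcover (measure_ne_top _ _)
    _ ≤ ∑ u ∈ Finset.range T, (sitePercolation (Site 2) p).real (⋃ q ∈ I, E u q) := measureReal_biUnion_finset_le _ _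
    _ ≤ ∑ u ∈ Finset.range T, ∑ q ∈ I, (sitePercolation (Site 2) p).real (E u q) :=
        Finset.sum_le_sum fun u _ => measureReal_biUnion_finset_le _ _
    _ ≤ ∑ u ∈ Finset.range T, ∑ q ∈ I, (sitePercolation (Site 2) p).real {ω | Q.lowestSeq ω u = some q} * ε :=
        Finset.sum_le_sum fun u _ => Finset.sum_le_sum fun q hq => hterm u q hq
    _ = ∑ u ∈ Finset.range T, (∑ q ∈ I, (sitePercolation (Site 2) p).real {ω | Q.lowestSeq ω u = some q}) * ε := by
        refine Finset.sum_congr rfl fun u _ => ?_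
        rw [Finset.sum_mul]
    _ ≤ ∑ u ∈ Finset.range T, 1 * ε :=
        Finset.sum_le_sum fun u _ => mul_le_mul_of_nonneg_right
          (sum_real_lowestSeq_eq_le_one hcut hdual p u I) hε
    _ = T * ε := by simp

end JDomain

end Literature.Probability.Percolation
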